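import Summits.Schanuel.Schanuel.Theorems.ZilberEacDensityRealSlopeLemmas
import Summits.Schanuel.Schanuel.Theorems.ZilberEacBranchOneDirection
import HarnessLib

/-!
# Arbitrary base branches, XXXI: POLE and ZERO fibre values — the exponential points along a
# base branch when `y₀ = ψ(s)s^L`, `L ∈ ℤ ∖ {0}`

HONEST FRAMING.  Cell `pub-schanuel` (Zilber's Exponential-Algebraic Closedness, case ladder;
host summit Schanuel), seat 2, gen 29.  All branch theorems so far (files I–XXX) concern fibre
values `y₀ = ψ(s) → θ ≠ 0` finite along the base branch `x₀ = s^{-k}`: the chart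
`2πi·m^{-k} = s^{-k} − log(ψ/θ) − τ` is analytic.  For a POLE or ZERO of the fibre value,
`y₀ = ψ(s)s^L` with `L ≠ 0` (e.g. every non-constant polynomial graph fibre `y₀ = R(x₀, x₁)` at a
place at infinity where `R` has a pole), the condition `e^{x₀} = y₀` reads
`s^{-k} = 2πin + L log s + log ψ(s)` and has a `log s` term — no analytic chart in a uniformiser.
Here the exponential points are produced directly (the "soft route" of the cell's notes): on the
sheet of the branch with tangent `z` (`z^k = 2πi`) write `s = z^{-1} n^{-1/k} e^{-Log(q)/k}`,
`x₀ = s^{-k} = 2πin·q`, `q = 1 + (−(L/k)log n + w)/(2πin)`; then `e^{x₀} = y₀` becomes the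
fixed-point equation `e^{w} = z^{-L}ψ(s)e^{−(L/k)Log q}` whose right side tends to the constant
`c₀ = z^{-L}ψ(0)` uniformly for `w` bounded, so by the minimum-modulus zero lemma of the tree
(`exists_zero_of_norm_lt_of_sphere`, Rouché's substitute) it has a solution `w_n` near `Log c₀` for
every large `n`: **`exists_poleFibre_expPoints`** — a sequence `s_j → 0`, `s_j ≠ 0`,
`s_j = z^{-1}·exp(−log(N₀ + j)/k)·u_j` with `u_j → 1`, and `exp(s_j^{-k}) = ψ(s_j)s_j^L`.  The next
file turns these points into density (growth `|Re x₁| ≍ n^{M/k}` in a good direction).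
Infrastructure; no density statement in this file.  EC(3,2) OPEN; NOT Schanuel's conjecture.
-/

noncomputable section

open Filter Topology Metric Complex

set_option linter.dupNamespace false

namespace Summit.Schanuel.Schanuel.Theorems

/-- Continuity package at `q = 1`: for `η > 0` there is `δ > 0` such that `‖q − 1‖ < δ` implies
`q ∈ slitPlane`, `‖e^{-Log(q)/k} − 1‖ < η` and `‖e^{a Log q} − 1‖ < η`. [folklore] -/
theorem exists_delta_log_powers_near_one (k : ℕ) (a : ℂ) {η : ℝ} (hη : 0 < η) :
    ∃ δ > 0, ∀ q : ℂ, ‖q - 1‖ < δ → q ∈ slitPlane ∧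
      ‖Complex.exp (-(Complex.log q) / k) - 1‖ < η ∧ ‖Complex.exp (a * Complex.log q) - 1‖ < η := by
  have hlog : ContinuousAt Complex.log (1 : ℂ) := continuousAt_clog Complex.one_mem_slitPlane
  have h1 : ContinuousAt (fun q : ℂ => Complex.exp (-(Complex.log q) / k)) 1 :=
    (hlog.neg.div_const _).cexp
  have h2 : ContinuousAt (fun q : ℂ => Complex.exp (a * Complex.log q)) 1 :=
    (continuousAt_const.mul hlog).cexp
  have h1' := (Metric.continuousAt_iff.1 h1) η hη
  have h2' := (Metric.continuousAt_iff.1 h2) η hη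
  simp only [Complex.log_one, neg_zero, zero_div, Complex.exp_zero, mul_zero, dist_eq_norm] at h1' h2'
  obtain ⟨δ₁, hδ₁, h1''⟩ := h1'
  obtain ⟨δ₂, hδ₂, h2''⟩ := h2'
  obtain ⟨δ₃, hδ₃, h3⟩ := Metric.isOpen_iff.1 Complex.isOpen_slitPlane 1 Complex.one_mem_slitPlane
  refine ⟨min δ₁ (min δ₂ δ₃), lt_min hδ₁ (lt_min hδ₂ hδ₃), fun q hq => ⟨?_, ?_, ?_⟩⟩
  · exact h3 (mem_ball.2 (by rw [dist_eq_norm]; exact hq.trans_le ((min_le_right _ _).trans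
      (min_le_right _ _))))
  · exact h1'' (hq.trans_le (min_le_left _ _))
  · exact h2'' (hq.trans_le ((min_le_right _ _).trans (min_le_left _ _)))

/-- `(‖a‖·log n + C)/(2πn) → 0`. [folklore] -/
theorem tendsto_log_label_div (A C : ℝ) :
    Tendsto (fun n : ℕ => (A * Real.log n + C) / (2 * Real.pi * n)) atTop (𝓝 0) := by
  have h1 : Tendsto (fun x : ℝ => Real.log x / x) atTop (𝓝 0) :=
    Real.isLittleO_log_id_atTop.tendsto_div_nhds_zero
  have h1' : Tendsto (fun n : ℕ => Real.log n / n) atTop (𝓝 0) :=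
    h1.comp tendsto_natCast_atTop_atTop
  have h2 : Tendsto (fun n : ℕ => C / (n : ℝ)) atTop (𝓝 0) := tendsto_const_div_atTop_nhds_zero_nat C
  have h := (h1'.const_mul (A / (2 * Real.pi))).add (h2.const_mul (1 / (2 * Real.pi)))
  rw [mul_zero, mul_zero, add_zero] at h
  refine h.congr' ?_
  filter_upwards [eventually_ge_atTop 1] with n hn
  have hn' : (0 : ℝ) < n := by exact_mod_cast hn
  field_simp

/-- **Exponential points on a base branch with a pole or zero fibre value.**  Let `k ≥ 1`,
`L ∈ ℤ`, `ψ` analytic at `0` with `ψ(0) ≠ 0`, and `z^k = 2πi`.  There are `N₀ ≥ 1`, `u_j → 1`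
(`u_j ≠ 0`) and `s_j = z^{-1}·e^{−log(N₀ + j)/k}·u_j` (so `s_j ≠ 0`, `s_j → 0`) with
`exp(s_j^{-k}) = ψ(s_j)·s_j^L` for every `j` — i.e. the points `(s_j^{-k}, ·, ψ(s_j)s_j^L, ·)` of the
cylinder over the branch are exponential in the first coordinate pair.  The finer structure
`u_j = e^{−Log(q_j)/k}`, `q_j = 1 + (−(L/k)log n_j + w_j)/(2πi n_j)` with `w_j` BOUNDED is recorded
for the second-order asymptotics (the logarithmic term of the residue class). [folklore] -/
theorem exists_poleFibre_expPoints {k : ℕ} (hk : 1 ≤ k) (L : ℤ) {ψ : ℂ → ℂ}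
    (hψ : AnalyticAt ℂ ψ 0) (hψ0 : ψ 0 ≠ 0) {z : ℂ} (hz : z ^ k = 2 * Real.pi * I) :
    ∃ (N₀ : ℕ) (u s w : ℕ → ℂ) (W : ℝ), 1 ≤ N₀ ∧ Tendsto u atTop (𝓝 1) ∧ (∀ j, u j ≠ 0) ∧
      (∀ j, ‖w j‖ ≤ W) ∧
      (∀ j, u j = Complex.exp (-(Complex.log (1 + ((-(L : ℂ) / k) * (Real.log ((N₀ + j : ℕ) : ℝ) : ℂ)
        + w j) / (((N₀ + j : ℕ) : ℂ) * (2 * Real.pi * I)))) / k)) ∧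
      (∀ j, s j = z⁻¹ * Complex.exp (-(Real.log ((N₀ + j : ℕ) : ℝ) : ℂ) / k) * u j) ∧
      (∀ j, s j ≠ 0) ∧ Tendsto s atTop (𝓝 0) ∧
      ∀ j, Complex.exp ((s j ^ k)⁻¹) = ψ (s j) * s j ^ L := by
  classical
  have hk0 : k ≠ 0 := by omega
  have hkC : (k : ℂ) ≠ 0 := Nat.cast_ne_zero.2 hk0
  have h2πI : (2 * Real.pi * I : ℂ) ≠ 0 := by simp [Real.pi_ne_zero, Complex.I_ne_zero]
  have hz0 : z ≠ 0 := by
    rintro rfl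
    rw [zero_pow hk0] at hz
    exact h2πI hz.symm
  -- constants
  set a : ℂ := -(L : ℂ) / k with ha
  set c₀ : ℂ := z⁻¹ ^ L * ψ 0 with hc₀
  have hzL : z⁻¹ ^ L ≠ 0 := zpow_ne_zero _ (inv_ne_zero hz0)
  have hc₀0 : c₀ ≠ 0 := mul_ne_zero hzL hψ0
  set w₀ : ℂ := Complex.log c₀ with hw₀
  have hew₀ : Complex.exp w₀ = c₀ := Complex.exp_log hc₀0
  -- the limit function `h(w) = e^w − c₀` and its sphere
  set h : ℂ → ℂ := fun w => Complex.exp w - c₀ with hh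
  have hhd : Differentiable ℂ h := Complex.differentiable_exp.sub_const _
  have hhne : ∃ w, h w ≠ 0 := by
    refine ⟨Complex.log (2 * c₀), ?_⟩
    simp only [hh]
    rw [Complex.exp_log (mul_ne_zero two_ne_zero hc₀0)]
    intro h0
    apply hc₀0
    linear_combination h0
  have hhw₀ : h w₀ = 0 := by simp [hh, hew₀]
  obtain ⟨r, hr0, hr1, m, hm0, hm⟩ := exists_sphere_norm_le hhd hhne w₀ one_pos
  -- the `n`-dependent objects
  set q : ℕ → ℂ → ℂ := fun n w => 1 + (a * (Real.log n : ℂ) + w) / ((n : ℂ) * (2 * Real.pi * I))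
    with hq
  set f₁ : ℂ → ℂ := fun q' => Complex.exp (-(Complex.log q') / k) with hf₁
  set f₂ : ℂ → ℂ := fun q' => Complex.exp (a * Complex.log q') with hf₂
  set E : ℕ → ℂ := fun n => Complex.exp (-(Real.log n : ℂ) / k) with hE
  set sf : ℕ → ℂ → ℂ := fun n w => z⁻¹ * E n * f₁ (q n w) with hsf
  set G : ℕ → ℂ → ℂ := fun n w => Complex.exp w - z⁻¹ ^ L * ψ (sf n w) * f₂ (q n w) with hG
  -- `‖q − 1‖ ≤ δ_n → 0` uniformly on `closedBall w₀ 2`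
  have hq1 : ∀ n : ℕ, 1 ≤ n → ∀ w ∈ closedBall w₀ 2,
      ‖q n w - 1‖ ≤ (‖a‖ * Real.log n + (‖w₀‖ + 2)) / (2 * Real.pi * n) := by
    intro n hn w hw
    have hnpos : (0 : ℝ) < n := by exact_mod_cast hn
    have hlog0 : 0 ≤ Real.log n := Real.log_nonneg (by exact_mod_cast hn)
    have hw' : ‖w‖ ≤ ‖w₀‖ + 2 := by
      have h1 := mem_closedBall.1 hw
      rw [dist_eq_norm] at h1
      have := norm_le_norm_add_norm_sub' w w₀
      linarith [norm_sub_rev w w₀]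
    have hden : ‖(n : ℂ) * (2 * Real.pi * I)‖ = 2 * Real.pi * n := by
      rw [norm_mul, Complex.norm_natCast]
      simp [abs_of_pos Real.pi_pos]
      ring
    rw [hq]
    simp only [add_sub_cancel_left, norm_div, hden]
    refine div_le_div_of_nonneg_right ?_ (by positivity)
    calc ‖a * (Real.log n : ℂ) + w‖ ≤ ‖a * (Real.log n : ℂ)‖ + ‖w‖ := norm_add_le _ _
      _ = ‖a‖ * Real.log n + ‖w‖ := by
          rw [norm_mul, Complex.norm_real, Real.norm_eq_abs, abs_of_nonneg hlog0]
      _ ≤ ‖a‖ * Real.log n + (‖w₀‖ + 2) := by linarith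
  have hδ := tendsto_log_label_div ‖a‖ (‖w₀‖ + 2)
  have hEt : Tendsto (fun n : ℕ => ‖E n‖) atTop (𝓝 0) := by
    have h1 : Tendsto (fun n : ℕ => Real.exp (-(Real.log n) / k)) atTop (𝓝 0) := by
      have hl : Tendsto (fun n : ℕ => -(Real.log n) / k) atTop atBot := by
        have := (Real.tendsto_log_atTop.comp tendsto_natCast_atTop_atTop)
        have h' : Tendsto (fun n : ℕ => Real.log n / k) atTop atTop :=
          this.atTop_div_const (by exact_mod_cast Nat.pos_of_ne_zero hk0)
        refine (tendsto_neg_atTop_atBot.comp h').congr fun n => ?_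
        simp [neg_div]
      exact Real.tendsto_exp_atBot.comp hl
    refine h1.congr fun n => ?_
    rw [hE]
    simp only
    rw [show (-(Real.log n : ℂ) / k) = ((-(Real.log n) / k : ℝ) : ℂ) by push_cast; ring,
      ← Complex.ofReal_exp, Complex.norm_real, Real.norm_eq_abs, abs_of_pos (Real.exp_pos _)]
  -- the uniform statement
  have hev : ∀ η > 0, ∀ᶠ n : ℕ in atTop, 1 ≤ n ∧ ∀ w ∈ closedBall w₀ 2,
      q n w ∈ slitPlane ∧ ‖sf n w‖ < η ∧ ‖f₂ (q n w) - 1‖ < η := by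
    intro η hη
    obtain ⟨δ, hδ0, hδq⟩ := exists_delta_log_powers_near_one k a (lt_min hη one_pos)
    have hzi : 0 < ‖z⁻¹‖ := norm_pos_iff.2 (inv_ne_zero hz0)
    filter_upwards [eventually_ge_atTop 1, (tendsto_order.1 hδ).2 δ hδ0,
      (tendsto_order.1 hEt).2 (η / (2 * ‖z⁻¹‖)) (by positivity)] with n hn hδn hEn
    refine ⟨hn, fun w hw => ?_⟩
    have hqn : ‖q n w - 1‖ < δ := (hq1 n hn w hw).trans_lt hδn
    obtain ⟨hslit, hf1, hf2⟩ := hδq (q n w) hqn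
    refine ⟨hslit, ?_, hf2.trans_le (min_le_left _ _)⟩
    have hf1' : ‖f₁ (q n w)‖ < 2 := by
      have := norm_le_norm_add_norm_sub' (f₁ (q n w)) 1
      rw [norm_one] at this
      have h' : ‖f₁ (q n w) - 1‖ < 1 := hf1.trans_le (min_le_right _ _)
      linarith
    rw [hsf]
    simp only [norm_mul]
    have hE0 : 0 ≤ ‖E n‖ := norm_nonneg _
    calc ‖z⁻¹‖ * ‖E n‖ * ‖f₁ (q n w)‖ ≤ ‖z⁻¹‖ * ‖E n‖ * 2 := by
          exact mul_le_mul_of_nonneg_left hf1'.le (by positivity)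
      _ < ‖z⁻¹‖ * (η / (2 * ‖z⁻¹‖)) * 2 := by
          have : ‖z⁻¹‖ * ‖E n‖ < ‖z⁻¹‖ * (η / (2 * ‖z⁻¹‖)) := mul_lt_mul_of_pos_left hEn hzi
          linarith
      _ = η * (‖z⁻¹‖ / ‖z⁻¹‖) := by ring
      _ = η := by rw [div_self hzi.ne', mul_one]
  -- `ψ` near `0`: differentiable on a ball, continuous at `0`
  obtain ⟨ρ, hρ0, hψρ⟩ : ∃ ρ > 0, ∀ s : ℂ, ‖s‖ < ρ → DifferentiableAt ℂ ψ s := by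
    obtain ⟨ρ, hρ0, h⟩ := Metric.eventually_nhds_iff.1 hψ.eventually_analyticAt
    exact ⟨ρ, hρ0, fun s hs => (h (by rwa [dist_zero_right])).differentiableAt⟩
  have hψc : ∀ η > 0, ∃ δ > 0, ∀ s : ℂ, ‖s‖ < δ → ‖ψ s - ψ 0‖ < η := by
    intro η hη
    obtain ⟨δ, hδ0, h⟩ := (Metric.continuousAt_iff.1 hψ.continuousAt) η hη
    exact ⟨δ, hδ0, fun s hs => by rw [← dist_eq_norm]; exact h (by rwa [dist_zero_right])⟩
  -- tolerances
  set Z : ℝ := ‖z⁻¹ ^ L‖ with hZ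
  have hZ0 : 0 < Z := norm_pos_iff.2 hzL
  obtain ⟨δψ, hδψ0, hδψ⟩ := hψc (m / (8 * Z)) (by positivity)
  set ηf : ℝ := m / (4 * Z * (‖ψ 0‖ + 1)) with hηf
  have hηf0 : 0 < ηf := by positivity
  have hmain : ∀ᶠ n : ℕ in atTop, 1 ≤ n ∧ (∀ w ∈ closedBall w₀ 2, q n w ∈ slitPlane ∧
      ‖sf n w‖ < min δψ ρ ∧ ‖f₂ (q n w) - 1‖ < min ηf 1) := by
    filter_upwards [hev (min (min δψ ρ) (min ηf 1)) (lt_min (lt_min hδψ0 hρ0) (lt_min hηf0 one_pos))]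
      with n hn
    exact ⟨hn.1, fun w hw => ⟨(hn.2 w hw).1, (hn.2 w hw).2.1.trans_le (min_le_left _ _),
      (hn.2 w hw).2.2.trans_le (min_le_right _ _)⟩⟩
  -- for such `n`: a zero of `G n` in `ball w₀ r`
  have hzero : ∀ᶠ n : ℕ in atTop, 1 ≤ n ∧ ∃ w ∈ ball w₀ r, G n w = 0 := by
    filter_upwards [hmain] with n hn
    obtain ⟨hn1, hunif⟩ := hn
    refine ⟨hn1, ?_⟩
    -- differentiability on `ball w₀ 2`
    have hdiff : DifferentiableOn ℂ (G n) (ball w₀ 2) := by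
      intro w hw
      have hw' : w ∈ closedBall w₀ 2 := ball_subset_closedBall hw
      obtain ⟨hslit, hsmall, -⟩ := hunif w hw'
      have hqd : DifferentiableAt ℂ (q n) w := by
        rw [hq]
        simp only
        fun_prop
      have hlogd : DifferentiableAt ℂ (fun w => Complex.log (q n w)) w := hqd.clog hslit
      have hf1d : DifferentiableAt ℂ (fun w => f₁ (q n w)) w := by
        rw [hf₁]
        exact (hlogd.neg.div_const _).cexp
      have hf2d : DifferentiableAt ℂ (fun w => f₂ (q n w)) w := by
        rw [hf₂]
        exact (hlogd.const_mul _).cexp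
      have hsfd : DifferentiableAt ℂ (sf n) w := by
        rw [hsf]
        exact (differentiableAt_const _).mul hf1d
      have hψd : DifferentiableAt ℂ (fun w => ψ (sf n w)) w :=
        (hψρ _ (hsmall.trans_le (min_le_right _ _))).comp w hsfd
      have hGd : DifferentiableAt ℂ (G n) w := by
        rw [hG]
        exact Complex.differentiable_exp.differentiableAt.sub
          (((differentiableAt_const _).mul hψd).mul hf2d)
      exact hGd.differentiableWithinAt
    -- the uniform estimate `‖G n w − h w‖ < m/2` on `closedBall w₀ 2`
    have hest : ∀ w ∈ closedBall w₀ 2, ‖G n w - h w‖ < m / 2 := by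
      intro w hw
      obtain ⟨-, hsmall, hf2⟩ := hunif w hw
      have hψs : ‖ψ (sf n w) - ψ 0‖ < m / (8 * Z) := hδψ _ (hsmall.trans_le (min_le_left _ _))
      have hf2' : ‖f₂ (q n w) - 1‖ < ηf := hf2.trans_le (min_le_left _ _)
      have hf2'' : ‖f₂ (q n w)‖ ≤ 2 := by
        have := norm_le_norm_add_norm_sub' (f₂ (q n w)) 1
        rw [norm_one] at this
        linarith [hf2.trans_le (min_le_right ηf 1)]
      have hid : G n w - h w = z⁻¹ ^ L * ((ψ 0 - ψ (sf n w)) * f₂ (q n w) + ψ 0 * (1 - f₂ (q n w))) := by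
        rw [hG, hh, hc₀]
        ring
      rw [hid, norm_mul, ← hZ]
      have h1 : ‖(ψ 0 - ψ (sf n w)) * f₂ (q n w) + ψ 0 * (1 - f₂ (q n w))‖ ≤
          m / (8 * Z) * 2 + ‖ψ 0‖ * ηf := by
        refine (norm_add_le _ _).trans (add_le_add ?_ ?_)
        · rw [norm_mul, norm_sub_rev]
          exact mul_le_mul hψs.le hf2'' (norm_nonneg _) (by positivity)
        · rw [norm_mul, norm_sub_rev]
          exact mul_le_mul_of_nonneg_left hf2'.le (norm_nonneg _)
      calc Z * ‖(ψ 0 - ψ (sf n w)) * f₂ (q n w) + ψ 0 * (1 - f₂ (q n w))‖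
          ≤ Z * (m / (8 * Z) * 2 + ‖ψ 0‖ * ηf) := mul_le_mul_of_nonneg_left h1 hZ0.le
        _ = m / 4 + m / 4 * (‖ψ 0‖ / (‖ψ 0‖ + 1)) := by rw [hηf]; field_simp; ring
        _ < m / 4 + m / 4 * 1 := by
          have : ‖ψ 0‖ / (‖ψ 0‖ + 1) < 1 := by
            rw [div_lt_one (by positivity)]
            linarith
          have hm4 : 0 < m / 4 := by positivity
          nlinarith
        _ = m / 2 := by ring
    have hsph : ∀ w ∈ sphere w₀ r, m / 2 ≤ ‖G n w‖ := by
      intro w hw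
      have hw2 : w ∈ closedBall w₀ 2 :=
        sphere_subset_closedBall.trans (closedBall_subset_closedBall (by linarith)) hw
      have h1 := hm w hw
      have h2 := hest w hw2
      have h3 := norm_sub_norm_le (h w) (G n w)
      rw [norm_sub_rev (h w) (G n w)] at h3
      linarith
    have hcen : ‖G n w₀‖ < m / 2 := by
      have := hest w₀ (mem_closedBall_self (by norm_num))
      rwa [hhw₀, sub_zero] at this
    exact exists_zero_of_norm_lt_of_sphere hr0 (by linarith : r < 2) hdiff hsph hcen
  -- extract the sequence
  obtain ⟨N₁, hN₁⟩ := Filter.eventually_atTop.1 (hzero.and hmain)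
  set N₀ : ℕ := max N₁ 1 with hN₀
  have hN₀1 : 1 ≤ N₀ := le_max_right _ _
  have hP : ∀ j : ℕ, (1 ≤ N₀ + j ∧ ∃ w ∈ ball w₀ r, G (N₀ + j) w = 0) ∧
      (1 ≤ N₀ + j ∧ ∀ w ∈ closedBall w₀ 2, q (N₀ + j) w ∈ slitPlane ∧
        ‖sf (N₀ + j) w‖ < min δψ ρ ∧ ‖f₂ (q (N₀ + j) w) - 1‖ < min ηf 1) :=
    fun j => hN₁ (N₀ + j) ((le_max_left _ _).trans (Nat.le_add_right _ _))
  choose w hwball hGw using fun j => (hP j).1.2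
  refine ⟨N₀, fun j => f₁ (q (N₀ + j) (w j)), fun j => sf (N₀ + j) (w j), w, ‖w₀‖ + 1, hN₀1, ?_, ?_,
    ?_, ?_, ?_, ?_, ?_, ?_⟩
  · -- `u_j → 1`: `q_j → 1` and `f₁` continuous at `1`
    have hqt : Tendsto (fun j => q (N₀ + j) (w j)) atTop (𝓝 1) := by
      rw [tendsto_iff_norm_sub_tendsto_zero]
      have hδ' : Tendsto (fun j : ℕ => (‖a‖ * Real.log ((N₀ + j : ℕ) : ℝ) + (‖w₀‖ + 2)) /
          (2 * Real.pi * ((N₀ + j : ℕ) : ℝ))) atTop (𝓝 0) :=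
        hδ.comp (tendsto_add_atTop_nat N₀ |>.congr fun j => by ring_nf)
      refine squeeze_zero (fun j => norm_nonneg _) (fun j => ?_) hδ'
      have hwj : w j ∈ closedBall w₀ 2 :=
        (ball_subset_closedBall.trans (closedBall_subset_closedBall (by linarith))) (hwball j)
      exact hq1 (N₀ + j) (hP j).1.1 (w j) hwj
    have hf1c : ContinuousAt f₁ 1 := by
      rw [hf₁]
      exact ((continuousAt_clog Complex.one_mem_slitPlane).neg.div_const _).cexp
    have hf11 : f₁ 1 = 1 := by simp [hf₁]
    have := hf1c.tendsto.comp hqt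
    rw [hf11] at this
    exact this
  · intro j
    exact Complex.exp_ne_zero _
  · intro j
    have h1 := mem_ball.1 (hwball j)
    rw [dist_eq_norm] at h1
    have := norm_le_norm_add_norm_sub' (w j) w₀
    linarith
  · intro j
    rfl
  · intro j
    rfl
  · intro j
    simp only [hsf, hE, hf₁]
    exact mul_ne_zero (mul_ne_zero (inv_ne_zero hz0) (Complex.exp_ne_zero _)) (Complex.exp_ne_zero _)
  · -- `s_j → 0`: `‖s_j‖ < anything` eventually, from `hev`
    rw [Metric.tendsto_nhds]
    intro ε hε
    have h := hev ε hε
    obtain ⟨N₂, hN₂⟩ := Filter.eventually_atTop.1 h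
    filter_upwards [eventually_ge_atTop N₂] with j hj
    rw [dist_zero_right]
    have hwj : w j ∈ closedBall w₀ 2 :=
      (ball_subset_closedBall.trans (closedBall_subset_closedBall (by linarith))) (hwball j)
    exact ((hN₂ (N₀ + j) (hj.trans (Nat.le_add_left _ _))).2 (w j) hwj).2.1
  · -- the equation
    intro j
    set n : ℕ := N₀ + j with hn
    have hn1 : 1 ≤ n := (hP j).1.1
    have hnC : (n : ℂ) ≠ 0 := Nat.cast_ne_zero.2 (by omega)
    have hwj : w j ∈ closedBall w₀ 2 :=
      (ball_subset_closedBall.trans (closedBall_subset_closedBall (by linarith))) (hwball j)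
    obtain ⟨hslit, -, -⟩ := (hP j).2.2 (w j) hwj
    have hq0 : q n (w j) ≠ 0 := Complex.slitPlane_ne_zero hslit
    have hGj : Complex.exp (w j) = z⁻¹ ^ L * ψ (sf n (w j)) * f₂ (q n (w j)) := by
      have := hGw j
      rw [hG] at this
      exact sub_eq_zero.1 this
    -- `s^k = z^{-k} e^{-log n} e^{-Log q} = (2πi n q)^{-1}`
    have hEk : E n ^ k = ((n : ℂ))⁻¹ := by
      rw [hE]
      simp only
      rw [← Complex.exp_nat_mul, show (k : ℂ) * (-(Real.log n : ℂ) / k) = -(Real.log n : ℂ) by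
        field_simp, Complex.exp_neg, ← Complex.ofReal_exp, Real.exp_log (by exact_mod_cast hn1),
        Complex.ofReal_natCast]
    have hf1k : f₁ (q n (w j)) ^ k = (q n (w j))⁻¹ := by
      rw [hf₁]
      simp only
      rw [← Complex.exp_nat_mul, show (k : ℂ) * (-(Complex.log (q n (w j))) / k) =
        -(Complex.log (q n (w j))) by field_simp, Complex.exp_neg, Complex.exp_log hq0]
    have hsk : (sf n (w j) ^ k)⁻¹ = (n : ℂ) * (2 * Real.pi * I) + (a * (Real.log n : ℂ) + w j) := by
      rw [hsf]
      simp only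
      rw [mul_pow, mul_pow, inv_pow, hz, hEk, hf1k, hq]
      field_simp
    -- `s^L = z^{-L} e^{a log n} e^{a Log q}`
    have hsL : sf n (w j) ^ L = z⁻¹ ^ L * Complex.exp (a * (Real.log n : ℂ)) *
        f₂ (q n (w j)) := by
      rw [hsf, hf₂, hE, hf₁]
      simp only
      rw [mul_zpow, mul_zpow, ← Complex.exp_int_mul, ← Complex.exp_int_mul, ha]
      have e1 : ((L : ℤ) : ℂ) * (-(Real.log n : ℂ) / k) = -((L : ℤ) : ℂ) / k * (Real.log n : ℂ) := by
        ring
      have e2 : ((L : ℤ) : ℂ) * (-(Complex.log (q n (w j))) / k) =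
          -((L : ℤ) : ℂ) / k * Complex.log (q n (w j)) := by
        ring
      rw [e1, e2]
    rw [hsk, Complex.exp_add, Complex.exp_nat_mul_two_pi_mul_I, one_mul, Complex.exp_add, hGj, hsL]
    ring

end Summit.Schanuel.Schanuel.Theorems

end
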